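import Literature.AlgebraicGeometry.HodgeTheory.SaitoGrFDeRhamCurveNet
import Mathlib.RingTheory.TensorProduct.Finite
import HarnessLib

/-!
# `curveNetSaitoData_nonempty` is equivalent to its Saito-free anchor (proof file)

Family `hodge`, layer `Literature/AlgebraicGeometry/HodgeTheory`. Companion to
`SaitoGrFDeRhamCurveNet`, whose named fact `curveNetSaitoData_nonempty` asserts, for every curve
net `N : Motives.CurveNet m X` over `ℂ` with `2 ≤ m`, the existence of a package
`CurveNetSaitoData N`: Saito's graded de Rham data `SaitoGrFDeRhamData m 1` of the pure Hodge module
`IC(R¹π_*ℚ)` on `ℙᵐ` (graded `ℂ[x₀,…,xₘ]`-modules `⊕_t ℍʲ(ℙᵐ, K_k(t))`, Kodaira–Saito vanishing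
[Saito1990, §2.g Prop. 2.33], intersection-cohomology Hodge structures and comparison
[SaitoMHP1988, Thm. 5.3.1], supports [Saito1990, §4.5]) TOGETHER WITH the anchor `ρ_F` to the real
carriers `complexBetti`, `classesSupportedOn`, `IsRationalClass`, `IsInHodgeFiltration` of the total
space `X̃ = N.total` (decomposition theorem [BBD1982, Thm. 6.2.5] and [DeligneHodgeII1971,
Cor. 3.2.17]).

Source read: M. Saito, *Mixed Hodge Modules*, Publ. RIMS 26 (1990) — Thm. 0.1 (p. 222: the
functors `f_*, f_!, f^*, f^!, ψ_g, φ_{g,1}, 𝔻, ⊠, ⊗, 𝓗om` on `DᵇMHM(X)` compatible with `rat`),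
Thm. 0.2 (p. 223: admissible variations of mixed Hodge structure are the smooth mixed Hodge
modules; p. 224: "we get a natural mixed Hodge structure on `H^•(X, L)`"), §2.g Prop. 2.33 (p. 273,
Kodaira vanishing `Hⁱ(Z, Gr^F_p DR_X(M,F) ⊗ L^{±1}) = 0` for `±i > 0`), §4.5 (pp. 324–327).

## What this file PROVES (no named fact is introduced, D-0026)

The module docstring of `SaitoGrFDeRhamCurveNet` ("Faithfulness") records that only the twist-`0`
data of the package are pinned to real carriers. This file turns that remark into a theorem, in
the sharpest form: **the Saito half of `CurveNetSaitoData N` imposes no constraint at all.** Every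
ANCHOR — the structure `CurveNetHodgeAnchor N` below: a finite-dimensional polarizable pure
`ℚ`-Hodge structure `I` of weight `m + 1`, sub-Hodge structures `I_T` of classes supported on
`T ⊆ ℙᵐ` (monotone, `I_{ℙᵐ} = I`, `I_∅ = 0`), and comparison maps
`ρ_F : H^{m+1}(X̃(ℂ); ℂ) → I_ℂ / (I_{V(F)})_ℂ` with the five properties `surjective_rho`, `ker_rho`,
`rho_mul`, `rho_rational`, `rho_hodgeFiltration` of `CurveNetSaitoData` — extends to a full
`CurveNetSaitoData N` (`CurveNetHodgeAnchor.toCurveNetSaitoData`) by the following degenerate but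
legitimate graded de Rham data: `IHᵐ := I`, `IH^{m+j} := 0` for `j ≠ 0`;
`⊕_t ℍ⁰(ℙᵐ, K_k(t)) := Gr_F^{-k} I_ℂ` placed in twist `t = 0`, all other pieces `0`; the
homogeneous coordinate ring acting through its augmentation `F ↦ F(0)`
(`MvPolynomial.constantCoeff`), so that forms of positive degree act by `0`. Then "functorial in
twists", the amplitude axioms and Kodaira–Saito vanishing hold vacuously, the comparison
`ℍ⁰(K_k) ≅ Gr_F^{-k} IHᵐ_ℂ` is the identity, and "Hodge support on `T ⊆ V(F)` ⇒ killed by a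
power of `F`" holds with exponent `1`: either `F(0) = 0` and `F` acts by `0`, or `F(0) ≠ 0`, in
which case `V(F) = ∅` (`projHypersurface_eq_empty_of_constantCoeff_ne_zero`), `T = ∅`, and the
section is `0`. Conversely every package restricts to its anchor (`CurveNetSaitoData.toAnchor`). So

* `curveNetSaitoData_nonempty_iff_anchor :
    curveNetSaitoData_nonempty ↔ ∀ N, 2 ≤ m → Nonempty (CurveNetHodgeAnchor N)`.

CONSEQUENCES for the consumer route (`HodgeConjecture/CurveNetMordellWeil`, crux
`VerticalSupportMiddle`). (1) The named fact is exactly as strong as the classical statement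
"there is a pure polarizable `ℚ`-Hodge structure anchored to `H^{m+1}(X̃(ℂ); ℂ)` (rational classes,
Hodge-model filtration) whose quotients by sub-Hodge structures realise
`H^{m+1}(X̃)/H^{m+1}_{π⁻¹V(F)}(X̃)` compatibly in `F`"; classically `I = H^{m+1}(X̃; ℚ)` itself with
`I_T = ker (H^{m+1}(X̃) → H^{m+1}(X̃ ∖ π⁻¹T̄))` qualifies (restriction to a Zariski open subset is a
morphism of mixed Hodge structures out of a pure one, [DeligneHodgeII1971, Cor. 3.2.17–3.2.18]),
so no intersection cohomology and no mixed Hodge module is needed for its truth, for ANY `m`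
(including `m = 1`). In the tree that classical statement rests on the undischarged named facts
`exists_isReal_hodgeModel`, `hodgePQ_independent_of_hodgeModel`,
`Deligne1974_ker_restrictCompl_eq_iSup_range_complexGysin` (plus the Gysin bidegree property and
the polarizability of `Hᵏ(X(ℂ); ℚ)`, which have no carrier-level statement in `Literature/`).
(2) Any route statement quantified over ALL packages `K : CurveNetSaitoData N` — in particular an
ENGINE "every section of `ℍ⁰(ℙᵐ, K_{-q})` is `IsHodgeSupportedSection` on some admissible
hypersurface" — must hold for the degenerate package of an arbitrary anchor, where
`ℍ⁰(K_{-q}) = Gr_F^q I_ℂ` and coherent support carries no information: such an engine is a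
statement about the anchor alone.

## References

* [Saito1990] M. Saito, Mixed Hodge modules, Publ. RIMS 26 (1990), Thm. 0.1–0.2, §2.g Prop. 2.33,
  §4.5. [SaitoMHP1988] Thm. 5.3.1. [BBD1982] Thm. 6.2.5.
* [DeligneHodgeII1971] P. Deligne, Théorie de Hodge II, Cor. 3.2.17–3.2.18.
-/

noncomputable section

open scoped TensorProduct
open CategoryTheory AlgebraicGeometry

namespace Literature.AlgebraicGeometry.HodgeTheory

section HodgeTheory

variable {m : ℕ} {X : Motives.SchemeOver ℂ}

/-! ### A polynomial with non-zero constant term has empty zero locus in `ℙᵐ` -/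

/-- If the constant term of `F ∈ ℂ[x₀, …, xₘ]` is non-zero then `V(F) = ∅`: a relevant homogeneous
prime containing `F` contains its degree-`0` component `F(0)`, a unit. [folklore] -/
theorem projHypersurface_eq_empty_of_constantCoeff_ne_zero (m : ℕ)
    {F : MvPolynomial (Fin (m + 1)) ℂ} (hF : MvPolynomial.constantCoeff F ≠ 0) :
    projHypersurface m F = ∅ := by
  letI := MvPolynomial.gradedAlgebra (σ := Fin (m + 1)) (R := ℂ)
  refine Set.eq_empty_iff_forall_notMem.mpr fun x hx => ?_
  have hFx : F ∈ (x : ProjectiveSpectrum (MvPolynomial.homogeneousSubmodule (Fin (m + 1)) ℂ)).asHomogeneousIdeal := by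
    have h : ({F} : Set (MvPolynomial (Fin (m + 1)) ℂ)) ⊆
        (x : ProjectiveSpectrum (MvPolynomial.homogeneousSubmodule (Fin (m + 1)) ℂ)).asHomogeneousIdeal := hx
    exact Set.singleton_subset_iff.mp h
  have h0 : MvPolynomial.homogeneousComponent 0 F ∈
      (x : ProjectiveSpectrum (MvPolynomial.homogeneousSubmodule (Fin (m + 1)) ℂ)).asHomogeneousIdeal.toIdeal :=
    MvPolynomial.homogeneousComponent_mem_of_mem
      (x : ProjectiveSpectrum (MvPolynomial.homogeneousSubmodule (Fin (m + 1)) ℂ)).asHomogeneousIdeal.isHomogeneous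
      (HomogeneousIdeal.mem_iff.mpr hFx) 0
  rw [MvPolynomial.homogeneousComponent_zero] at h0
  have hc : MvPolynomial.coeff 0 F ≠ 0 := by
    simpa [MvPolynomial.constantCoeff_eq] using hF
  have hunit : IsUnit (MvPolynomial.C (σ := Fin (m + 1)) (MvPolynomial.coeff 0 F)) :=
    (isUnit_iff_ne_zero.mpr hc).map MvPolynomial.C
  exact (x : ProjectiveSpectrum (MvPolynomial.homogeneousSubmodule (Fin (m + 1)) ℂ)).isPrime.ne_top
    (Ideal.eq_top_of_isUnit_mem _ h0 hunit)

/-! ### The anchor -/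

/-- **The Saito-free anchor of a curve net `N` on `ℙᵐ_ℂ`**: a finite-dimensional polarizable pure
`ℚ`-Hodge structure `I` of weight `m + 1` (intended: `IHᵐ(ℙᵐ, IC(R¹π_*ℚ))`; classically
`H^{m+1}(X̃; ℚ)` itself also qualifies), sub-Hodge structures `supported T ⊆ I` of classes
supported on `T ⊆ ℙᵐ` (monotone, everything on `ℙᵐ`, nothing on `∅`), and for every polynomial `F`
a comparison map `ρ_F : H^{m+1}(X̃(ℂ); ℂ) → I_ℂ / (supported V(F))_ℂ` which for admissible `F` is
surjective with kernel the classes supported on `π⁻¹V(F)`, compatible with `V(F) ⊆ V(F·G)`, defined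
over `ℚ` and filtered — verbatim the fields `IH 0`, `hodgeIH 0`, `ihSupported*` and `rho*` of
`CurveNetSaitoData N`, nothing else. [cite: DeligneHodgeII1971, Cor. 3.2.17]
[cite: BBD1982, Thm. 6.2.5] [cite: Saito1990, Thm. 0.1 and §4.5] -/
structure CurveNetHodgeAnchor (N : Motives.CurveNet m X) : Type 1 where
  /-- The rational vector space `I` (`IHᵐ`). [cite: SaitoMHP1988, Thm. 5.3.1] -/
  I : Type
  /-- … an abelian group … [cite: SaitoMHP1988, Thm. 5.3.1] -/
  [addCommGroup : AddCommGroup I]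
  /-- … a `ℚ`-vector space … [cite: SaitoMHP1988, Thm. 5.3.1] -/
  [module : Module ℚ I]
  /-- … of finite dimension. [cite: SaitoMHP1988, Thm. 5.3.1] -/
  finiteDimensional : FiniteDimensional ℚ I
  /-- The pure Hodge structure of weight `m + 1` on `I`. [cite: SaitoMHP1988, Thm. 5.3.1] -/
  hodge : Motives.HodgeStructure I ((m : ℤ) + 1)
  /-- `I` is polarizable. [cite: SaitoMHP1988, Thm. 5.3.1] -/
  isPolarizable : hodge.IsPolarizable
  /-- The sub-Hodge structure of classes supported on `T ⊆ ℙᵐ`. [cite: Saito1990, §4.5] -/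
  supported : Set (Motives.projectiveSpace m ℂ).left → hodge.SubHodgeStructure
  /-- Supports are monotone. [cite: Saito1990, §4.5] -/
  supported_mono : ∀ {T T' : Set (Motives.projectiveSpace m ℂ).left}, T ⊆ T' →
    (supported T).toSubmodule ≤ (supported T').toSubmodule
  /-- Everything is supported on `ℙᵐ`. [cite: Saito1990, §4.5] -/
  supported_univ : (supported Set.univ).toSubmodule = ⊤
  /-- Only `0` is supported on `∅`. [cite: Saito1990, §4.5] -/
  supported_empty : (supported ∅).toSubmodule = ⊥
  /-- The comparison map `ρ_F : H^{m+1}(X̃(ℂ); ℂ) → I_ℂ / (I_{V(F)})_ℂ`. [cite: BBD1982, Thm. 6.2.5] -/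
  rho : ∀ F : MvPolynomial (Fin (m + 1)) ℂ,
    ↥(complexBetti N.total (m + 1)) →ₗ[ℂ]
      (ℂ ⊗[ℚ] I) ⧸ ((supported (projHypersurface m F)).toSubmodule.baseChange ℂ)
  /-- `ρ_F` is onto for admissible `F`. [cite: DeligneHodgeII1971, Cor. 3.2.17] -/
  surjective_rho : ∀ F, N.IsAdmissibleForm F → Function.Surjective (rho F)
  /-- The kernel of `ρ_F` is the classes supported on `π⁻¹V(F)`. [cite: BBD1982, Thm. 6.2.5] -/
  ker_rho : ∀ F, N.IsAdmissibleForm F →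
    LinearMap.ker (rho F) = classesSupportedOn N.total (N.proj.left.base ⁻¹' projHypersurface m F) (m + 1)
  /-- Compatibility with enlarging the hypersurface. [cite: BBD1982, Thm. 6.2.5] -/
  rho_mul : ∀ F G, N.IsAdmissibleForm F → (∃ e' : ℕ, G.IsHomogeneous e') →
    ∀ (c : ↥(complexBetti N.total (m + 1))) (y : ℂ ⊗[ℚ] I),
      rho F c = Submodule.Quotient.mk y → rho (F * G) c = Submodule.Quotient.mk y
  /-- `ρ_F` is defined over `ℚ`. [cite: Saito1990, Thm. 0.1–0.2] -/
  rho_rational : ∀ F, N.IsAdmissibleForm F → ∀ c : ↥(complexBetti N.total (m + 1)),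
    IsRationalClass c → ∃ v : I, rho F c = Submodule.Quotient.mk (Motives.HodgeStructure.ofRat v)
  /-- `ρ_F` is filtered. [cite: Saito1990, Thm. 0.1–0.2] -/
  rho_hodgeFiltration : ∀ F, N.IsAdmissibleForm F → ∀ (r : ℕ) (c : ↥(complexBetti N.total (m + 1))),
    IsInHodgeFiltration (m + 1) N.total (m + 1) r c → ∃ y ∈ hodge.F r, rho F c = Submodule.Quotient.mk y

namespace CurveNetHodgeAnchor

attribute [instance] addCommGroup module

/-! ### Extension by zero of a module along `ℤ`: `V` in degree `0`, `0` elsewhere -/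

/-- The family of types `j ↦ V` for `j = 0` and `j ↦ PUnit` (the zero module) for `j ≠ 0`, by
pattern matching, so that the value at the literal `0` is `V` definitionally. [folklore] -/
abbrev zext (V : Type) : ℤ → Type
  | Int.ofNat 0 => V
  | Int.ofNat (_ + 1) => PUnit
  | Int.negSucc _ => PUnit

/-- The additive group structure on `zext V j`. [folklore] -/
abbrev zext.addCommGroup (V : Type) [AddCommGroup V] : ∀ j : ℤ, AddCommGroup (zext V j)
  | Int.ofNat 0 => ‹AddCommGroup V›
  | Int.ofNat (_ + 1) => inferInstanceAs (AddCommGroup PUnit)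
  | Int.negSucc _ => inferInstanceAs (AddCommGroup PUnit)

attribute [instance] zext.addCommGroup

/-- The module structure on `zext V j` over any semiring acting on `V`. [folklore] -/
abbrev zext.module (R : Type*) [Semiring R] (V : Type) [AddCommGroup V] [Module R V] :
    ∀ j : ℤ, Module R (zext V j)
  | Int.ofNat 0 => ‹Module R V›
  | Int.ofNat (_ + 1) => inferInstanceAs (Module R PUnit)
  | Int.negSucc _ => inferInstanceAs (Module R PUnit)

attribute [instance] zext.module

/-- Compatibility of two module structures on `zext V j`. [folklore] -/
theorem zext.isScalarTower (R S : Type*) [Semiring R] [Semiring S] (V : Type) [AddCommGroup V]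
    [Module R V] [Module S V] [SMul R S] [IsScalarTower R S V] :
    ∀ j : ℤ, IsScalarTower R S (zext V j)
  | Int.ofNat 0 => ‹IsScalarTower R S V›
  | Int.ofNat (_ + 1) => ⟨fun _ _ _ => Subsingleton.elim _ _⟩
  | Int.negSucc _ => ⟨fun _ _ _ => Subsingleton.elim _ _⟩

/-- Off degree `0` the extension by zero is a zero module. [folklore] -/
theorem zext.subsingleton (V : Type) : ∀ j : ℤ, j ≠ 0 → Subsingleton (zext V j)
  | Int.ofNat 0 => fun h => absurd rfl h
  | Int.ofNat (_ + 1) => fun _ => inferInstanceAs (Subsingleton PUnit)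
  | Int.negSucc _ => fun _ => inferInstanceAs (Subsingleton PUnit)

/-- `zext V j` is a finite module (given `V` is). [folklore] -/
theorem zext.finite (R : Type*) [Semiring R] (V : Type) [AddCommGroup V] [Module R V]
    [Module.Finite R V] : ∀ j : ℤ, Module.Finite R (zext V j)
  | Int.ofNat 0 => ‹Module.Finite R V›
  | Int.ofNat (_ + 1) => Module.Finite.of_finite
  | Int.negSucc _ => Module.Finite.of_finite

/-! ### Zero graded pieces and the zero Hodge structure -/

/-- A graded piece `Gr_F^p = F^p / F^{p+1}` of a Hodge filtration is zero when `F^p` is.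
[cite: DeligneHodgeII1971, 1.2.4–1.2.5] -/
theorem subsingleton_grF {W : Type} [AddCommGroup W] [Module ℚ W] {n : ℤ}
    (H : Motives.HodgeStructure W n) (p : ℤ) [Subsingleton ↥(H.F p)] : Subsingleton (H.grF p) := by
  refine ⟨fun x y => ?_⟩
  obtain ⟨x, rfl⟩ := Submodule.mkQ_surjective _ x
  obtain ⟨y, rfl⟩ := Submodule.mkQ_surjective _ y
  rw [Subsingleton.elim x y]

/-- A graded piece `Gr_F^p = F^p / F^{p+1}` vanishes when `F^{p+1}` is everything.
[cite: DeligneHodgeII1971, 1.2.4–1.2.5] -/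
theorem subsingleton_grF_of_eq_top {W : Type} [AddCommGroup W] [Module ℚ W] {n : ℤ}
    (H : Motives.HodgeStructure W n) {p : ℤ} (h : H.F (p + 1) = ⊤) : Subsingleton (H.grF p) := by
  refine ⟨fun x y => ?_⟩
  obtain ⟨x, rfl⟩ := Submodule.mkQ_surjective _ x
  obtain ⟨y, rfl⟩ := Submodule.mkQ_surjective _ y
  rw [← sub_eq_zero, ← map_sub, Submodule.mkQ_apply, Submodule.Quotient.mk_eq_zero,
    Submodule.mem_comap, h]
  exact Submodule.mem_top

section Zero

variable (V : Type) [AddCommGroup V] [Module ℚ V] [Subsingleton V]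

/-- The complexification of a zero module is zero. [folklore] -/
theorem subsingleton_complexification : Subsingleton (ℂ ⊗[ℚ] V) := by
  refine ⟨fun x y => ?_⟩
  have h : ∀ z : ℂ ⊗[ℚ] V, z = 0 := fun z => by
    induction z using TensorProduct.induction_on with
    | zero => rfl
    | tmul c v => rw [Subsingleton.elim v 0, TensorProduct.tmul_zero]
    | add a b ha hb => rw [ha, hb, add_zero]
  rw [h x, h y]

/-- The (unique) Hodge structure of weight `n` on a zero module: every `F^p` is `0 = V_ℂ`.
[cite: DeligneHodgeII1971, 1.2.4–1.2.5] -/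
def zeroHodgeStructure (n : ℤ) : Motives.HodgeStructure V n where
  F _ := ⊥
  antitone_F _ _ _ := le_rfl
  exists_F_eq_top := ⟨0, by
    haveI := subsingleton_complexification V
    haveI : Subsingleton (Submodule ℂ (ℂ ⊗[ℚ] V)) := (Submodule.subsingleton_iff ℂ).mpr inferInstance
    exact Subsingleton.elim _ _⟩
  exists_F_eq_bot := ⟨0, rfl⟩
  isCompl_F_complexConj _ _ _ := by
    haveI := subsingleton_complexification V
    haveI : Subsingleton (Submodule ℂ (ℂ ⊗[ℚ] V)) := (Submodule.subsingleton_iff ℂ).mpr inferInstance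
    show IsCompl (⊥ : Submodule ℂ (ℂ ⊗[ℚ] V)) (Motives.HodgeStructure.complexConj ⊥)
    rw [Subsingleton.elim (Motives.HodgeStructure.complexConj (⊥ : Submodule ℂ (ℂ ⊗[ℚ] V))) ⊤]
    exact isCompl_bot_top

/-- The zero form polarizes the zero Hodge structure (all conditions are vacuous).
[cite: DeligneHodgeII1971, 2.1.15] -/
def zeroPolarization (n : ℤ) : (zeroHodgeStructure V n).Polarization where
  form := 0
  flip_form := by ext x y; simp
  form_apply_eq_zero _ x _ y _ := by
    haveI := subsingleton_complexification V
    rw [Subsingleton.elim x 0, map_zero, LinearMap.zero_apply]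
  pos _ _ _ x _ hx := by
    haveI := subsingleton_complexification V
    exact absurd (Subsingleton.elim x 0) hx

/-- The zero Hodge structure is polarizable. [cite: DeligneHodgeII1971, 2.1.15] -/
theorem isPolarizable_zeroHodgeStructure (n : ℤ) : (zeroHodgeStructure V n).IsPolarizable :=
  ⟨zeroPolarization V n⟩

/-- The graded pieces of the zero Hodge structure are zero. [cite: DeligneHodgeII1971, 1.2.4–1.2.5] -/
theorem subsingleton_grF_zeroHodgeStructure (n p : ℤ) :
    Subsingleton ((zeroHodgeStructure V n).grF p) := by
  haveI := subsingleton_complexification V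
  exact subsingleton_grF _ p

end Zero

/-! ### The degenerate graded de Rham data of an anchor -/

variable {N : Motives.CurveNet m X} (A : CurveNetHodgeAnchor N)

/-- `I` is finite-dimensional (instance form of the field). [cite: SaitoMHP1988, Thm. 5.3.1] -/
instance instFiniteDimensionalI : FiniteDimensional ℚ A.I := A.finiteDimensional

/-- The homogeneous coordinate ring `S = ℂ[x₀, …, xₘ]` acting on a `ℂ`-vector space through its
augmentation `F ↦ F(0)` (constant coefficient): forms of positive degree act by `0`. [folklore] -/
abbrev augmentationModule (W : Type) [AddCommGroup W] [Module ℂ W] :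
    Module (MvPolynomial (Fin (m + 1)) ℂ) W :=
  Module.compHom W (MvPolynomial.constantCoeff : MvPolynomial (Fin (m + 1)) ℂ →+* ℂ)

/-- The augmentation action is compatible with the `ℂ`-structure. [folklore] -/
theorem isScalarTower_augmentationModule (W : Type) [AddCommGroup W] [Module ℂ W] :
    letI := augmentationModule (m := m) W
    IsScalarTower ℂ (MvPolynomial (Fin (m + 1)) ℂ) W :=
  letI := augmentationModule (m := m) W
  ⟨fun c F w => by
    change MvPolynomial.constantCoeff (c • F) • w = c • (MvPolynomial.constantCoeff F • w)
    rw [MvPolynomial.constantCoeff_smul, smul_eq_mul, mul_smul]⟩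

/-- The intersection-cohomology carriers of the degenerate package: `IHᵐ = I`, `IH^{m+j} = 0` for
`j ≠ 0`. [folklore] -/
abbrev ihCarrier (j : ℤ) : Type := zext A.I j

/-- The Hodge structures of the degenerate package: the given one on `IHᵐ = I`, zero elsewhere.
[folklore] -/
def ihHodge : ∀ j : ℤ, Motives.HodgeStructure (A.ihCarrier j) ((m : ℤ) + 1 + j)
  | Int.ofNat 0 => A.hodge
  | Int.ofNat (_ + 1) => zeroHodgeStructure _ _
  | Int.negSucc _ => zeroHodgeStructure _ _

/-- They are polarizable. [folklore] -/
theorem isPolarizable_ihHodge : ∀ j : ℤ, (A.ihHodge j).IsPolarizable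
  | Int.ofNat 0 => A.isPolarizable
  | Int.ofNat (_ + 1) => isPolarizable_zeroHodgeStructure _ _
  | Int.negSucc _ => isPolarizable_zeroHodgeStructure _ _

/-- Off degree `0` the graded pieces of the degenerate Hodge structures vanish. [folklore] -/
theorem subsingleton_grF_ihHodge (p : ℤ) : ∀ j : ℤ, j ≠ 0 → Subsingleton ((A.ihHodge j).grF p)
  | Int.ofNat 0 => fun h => absurd rfl h
  | Int.ofNat (_ + 1) => fun _ => subsingleton_grF_zeroHodgeStructure _ _ p
  | Int.negSucc _ => fun _ => subsingleton_grF_zeroHodgeStructure _ _ p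

/-- The hypercohomology carriers of the degenerate package: `⊕_t ℍ⁰(ℙᵐ, K_k(t)) := Gr_F^{-k} I_ℂ`
(everything in twist `0`), and `0` for `j ≠ 0`. [folklore] -/
abbrev hCarrier (k j : ℤ) : Type := zext (A.hodge.grF (-k)) j

/-- The twist grading of the degenerate package: everything sits in twist `t = 0`. [folklore] -/
def piece (k j t : ℤ) : Submodule ℂ (A.hCarrier k j) := if t = 0 then ⊤ else ⊥

/-- `piece k j 0 = ⊤`. [folklore] -/
@[simp]
theorem piece_zero (k j : ℤ) : A.piece k j 0 = ⊤ := if_pos rfl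

/-- `piece k j t = ⊥` for `t ≠ 0`. [folklore] -/
theorem piece_of_ne_zero (k j : ℤ) {t : ℤ} (ht : t ≠ 0) : A.piece k j t = ⊥ := if_neg ht

/-- The twist grading is an internal direct sum (one non-zero summand). [folklore] -/
theorem isInternal_piece (k j : ℤ) : DirectSum.IsInternal (A.piece k j) := by
  rw [DirectSum.isInternal_submodule_iff_iSupIndep_and_iSup_eq_top]
  refine ⟨fun t => ?_, eq_top_iff.mpr (le_iSup_of_le 0 (A.piece_zero k j).ge)⟩
  by_cases ht : t = 0
  · subst ht
    have h : (⨆ (s : ℤ) (_ : s ≠ (0 : ℤ)), A.piece k j s) = ⊥ :=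
      le_bot_iff.mp (iSup₂_le fun s hs => (A.piece_of_ne_zero k j hs).le)
    rw [h]
    exact disjoint_bot_right
  · rw [A.piece_of_ne_zero k j ht]
    exact disjoint_bot_left

/-- Off degree `j = 0` the hypercohomology carriers are zero. [folklore] -/
theorem piece_eq_bot_of_ne_zero (k : ℤ) {j : ℤ} (hj : j ≠ 0) (t : ℤ) : A.piece k j t = ⊥ := by
  haveI := zext.subsingleton (A.hodge.grF (-k)) j hj
  haveI : Subsingleton (Submodule ℂ (A.hCarrier k j)) := (Submodule.subsingleton_iff ℂ).mpr inferInstance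
  exact Subsingleton.elim _ _

/-- Lower end of the `F`-amplitude of the degenerate package: one above `-p₁`, where `F^{p₁} = 0`.
[folklore] -/
def kmin : ℤ := -A.hodge.exists_F_eq_bot.choose + 1

/-- Upper end of the `F`-amplitude of the degenerate package: `-p₀`, where `F^{p₀} = I_ℂ`.
[folklore] -/
def kmax : ℤ := -A.hodge.exists_F_eq_top.choose

/-- Below `kmin` the graded piece `Gr_F^{-k}` vanishes (`F^{-k} ⊆ F^{p₁} = 0`). [folklore] -/
theorem subsingleton_grF_of_lt_kmin {k : ℤ} (hk : k < A.kmin) : Subsingleton (A.hodge.grF (-k)) := by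
  have hle : A.hodge.exists_F_eq_bot.choose ≤ -k := by unfold kmin at hk; omega
  have hbot : A.hodge.F (-k) = ⊥ :=
    le_bot_iff.mp ((A.hodge.antitone_F hle).trans A.hodge.exists_F_eq_bot.choose_spec.le)
  haveI : Subsingleton ↥(A.hodge.F (-k)) := by
    rw [hbot]
    infer_instance
  exact subsingleton_grF _ _

/-- Above `kmax` the graded piece `Gr_F^{-k}` vanishes (`F^{-k+1} ⊇ F^{p₀} = I_ℂ`). [folklore] -/
theorem subsingleton_grF_of_kmax_lt {k : ℤ} (hk : A.kmax < k) : Subsingleton (A.hodge.grF (-k)) := by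
  have hle : -k + 1 ≤ A.hodge.exists_F_eq_top.choose := by unfold kmax at hk; omega
  exact subsingleton_grF_of_eq_top _
    (top_le_iff.mp (A.hodge.exists_F_eq_top.choose_spec.ge.trans (A.hodge.antitone_F hle)))

/-- If `Gr_F^{-k} = 0` then every piece of the degenerate package in row `k` is zero. [folklore] -/
theorem piece_eq_bot_of_subsingleton_grF {k : ℤ} (h : Subsingleton (A.hodge.grF (-k))) (j t : ℤ) :
    A.piece k j t = ⊥ := by
  by_cases hj : j = 0
  · subst hj
    haveI : Subsingleton (A.hCarrier k 0) := h
    haveI : Subsingleton (Submodule ℂ (A.hCarrier k 0)) := (Submodule.subsingleton_iff ℂ).mpr inferInstance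
    exact Subsingleton.elim _ _
  · exact A.piece_eq_bot_of_ne_zero k hj t

/-- The comparison `ℍ⁰(K_k) ≅ Gr_F^{-k} IH^{m+j}_ℂ` of the degenerate package: the identity in
degree `j = 0`, the zero isomorphism elsewhere. [folklore] -/
def comparison (k : ℤ) : ∀ j : ℤ, ↥(A.piece k j 0) ≃ₗ[ℂ] (A.ihHodge j).grF (-k)
  | Int.ofNat 0 => (LinearEquiv.ofEq _ _ (A.piece_zero k _)).trans Submodule.topEquiv
  | Int.ofNat (n + 1) =>
    haveI := zext.subsingleton (A.hodge.grF (-k)) (Int.ofNat (n + 1))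
      (fun h => Nat.succ_ne_zero n (Int.ofNat.inj h))
    haveI := A.subsingleton_grF_ihHodge (-k) (Int.ofNat (n + 1))
      (fun h => Nat.succ_ne_zero n (Int.ofNat.inj h))
    LinearEquiv.ofSubsingleton _ _
  | Int.negSucc n =>
    haveI := zext.subsingleton (A.hodge.grF (-k)) (Int.negSucc n) (fun h => Int.noConfusion h)
    haveI := A.subsingleton_grF_ihHodge (-k) (Int.negSucc n) (fun h => Int.noConfusion h)
    LinearEquiv.ofSubsingleton _ _

/-- A form of positive degree has zero constant term. [folklore] -/
theorem constantCoeff_eq_zero_of_mem_homogeneousSubmodule {e : ℕ} (he : e ≠ 0)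
    {F : MvPolynomial (Fin (m + 1)) ℂ} (hF : F ∈ MvPolynomial.homogeneousSubmodule (Fin (m + 1)) ℂ e) :
    MvPolynomial.constantCoeff F = 0 := by
  rw [MvPolynomial.mem_homogeneousSubmodule] at hF
  have h := hF.coeff_eq_zero (d := 0) (by simpa using fun h => he h.symm)
  simpa [MvPolynomial.constantCoeff_eq] using h

/-- **Hodge support ⇒ coherent support, degenerate package**: with the augmentation action, a
section Hodge-supported on `T ⊆ V(F)` is killed by `F` itself — either `F(0) = 0` and `F` acts by
`0`, or `V(F) = ∅`, `T = ∅`, and the section is `0` (`supported_empty`). [folklore] -/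
theorem exists_pow_smul_eq_zero (T : Set (Motives.projectiveSpace m ℂ).left)
    (F : MvPolynomial (Fin (m + 1)) ℂ) (hT : T ⊆ projHypersurface m F) (k : ℤ)
    (x : ↥(A.hodge.F (-k))) (hx : (x : ℂ ⊗[ℚ] A.I) ∈ ((A.supported T).toSubmodule).baseChange ℂ) :
    letI := augmentationModule (m := m) (A.hCarrier k 0)
    ∃ n : ℕ, F ^ n • (((A.comparison k 0).symm (A.hodge.grFMk (-k) x) : ↥(A.piece k 0 0)) :
      A.hCarrier k 0) = 0 := by
  letI := augmentationModule (m := m) (A.hCarrier k 0)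
  refine ⟨1, ?_⟩
  rw [pow_one]
  -- in degree `0` the comparison is the identity: the section is the class of `x` itself
  change MvPolynomial.constantCoeff F • (A.hodge.grFMk (-k) x : A.hCarrier k 0) = 0
  by_cases hF : MvPolynomial.constantCoeff F = 0
  · rw [hF, zero_smul]
  · have hTe : T = ∅ :=
      Set.subset_eq_empty hT (projHypersurface_eq_empty_of_constantCoeff_ne_zero m hF)
    subst hTe
    rw [A.supported_empty, Submodule.baseChange_bot, Submodule.mem_bot] at hx
    have hx0 : x = 0 := Subtype.ext hx
    rw [hx0, map_zero]
    exact smul_zero _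

/-- **Every anchor extends to a full package** `CurveNetSaitoData N` by the degenerate graded de
Rham data (module docstring): the Saito half of the package imposes no constraint.
[cite: Saito1990, Thm. 0.1, §2.g Prop. 2.33 and §4.5] -/
def toCurveNetSaitoData : CurveNetSaitoData N where
  kmin := A.kmin
  kmax := A.kmax
  H := A.hCarrier
  addCommGroup k j := zext.addCommGroup _ j
  module k j := zext.module ℂ _ j
  moduleS k j := @zext.module _ _ (A.hodge.grF (-k)) _ (augmentationModule (m := m) _) j
  isScalarTower k j :=
    @zext.isScalarTower ℂ (MvPolynomial (Fin (m + 1)) ℂ) _ _ (A.hodge.grF (-k)) _ _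
      (augmentationModule (m := m) _) _ (isScalarTower_augmentationModule (m := m) _) j
  piece := A.piece
  isInternal_piece := A.isInternal_piece
  smul_mem_piece := fun k j e t F hF x hx => by
    letI : Module (MvPolynomial (Fin (m + 1)) ℂ) (A.hCarrier k j) :=
      @zext.module _ _ (A.hodge.grF (-k)) _ (augmentationModule (m := m) _) j
    by_cases hte : t + (e : ℤ) = 0
    · rw [hte, A.piece_zero]
      exact Submodule.mem_top
    · rw [A.piece_of_ne_zero k j hte]
      refine (Submodule.mem_bot ℂ).mpr ?_
      by_cases ht : t = 0
      · subst ht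
        have he : e ≠ 0 := fun h => hte (by simp [h])
        by_cases hj : j = 0
        · subst hj
          change MvPolynomial.constantCoeff F • x = 0
          rw [constantCoeff_eq_zero_of_mem_homogeneousSubmodule he hF, zero_smul]
        · haveI := zext.subsingleton (A.hodge.grF (-k)) j hj
          exact Subsingleton.elim _ _
      · rw [A.piece_of_ne_zero k j ht] at hx
        rw [(Submodule.mem_bot ℂ).mp hx, smul_zero]
  finiteDimensional_piece k j t := by
    haveI : Module.Finite ℂ (A.hCarrier k j) := zext.finite ℂ _ j
    infer_instance
  piece_eq_bot_of_lt_kmin k j t hk :=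
    A.piece_eq_bot_of_subsingleton_grF (A.subsingleton_grF_of_lt_kmin hk) j t
  piece_eq_bot_of_kmax_lt k j t hk :=
    A.piece_eq_bot_of_subsingleton_grF (A.subsingleton_grF_of_kmax_lt hk) j t
  piece_eq_bot_of_lt_neg k j t hj := A.piece_eq_bot_of_ne_zero k (by omega) t
  piece_eq_bot_of_lt k j t hj := A.piece_eq_bot_of_ne_zero k (by omega) t
  piece_eq_bot_of_pos k j t _ ht := A.piece_of_ne_zero k j (by omega)
  piece_eq_bot_of_neg k j t _ ht := A.piece_of_ne_zero k j (by omega)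
  IH := A.ihCarrier
  addCommGroupIH j := zext.addCommGroup _ j
  moduleIH j := zext.module ℚ _ j
  finiteDimensional_IH j := zext.finite ℚ _ j
  subsingleton_IH j hj := zext.subsingleton _ j (by omega)
  hodgeIH := A.ihHodge
  isPolarizable_hodgeIH := A.isPolarizable_ihHodge
  comparison := A.comparison
  ihSupported := A.supported
  ihSupported_mono h := A.supported_mono h
  ihSupported_univ := A.supported_univ
  ihSupported_empty := A.supported_empty
  exists_pow_smul_eq_zero := A.exists_pow_smul_eq_zero
  rho := A.rho
  surjective_rho := A.surjective_rho
  ker_rho := A.ker_rho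
  rho_mul := A.rho_mul
  rho_rational := A.rho_rational
  rho_hodgeFiltration := A.rho_hodgeFiltration

end CurveNetHodgeAnchor

/-- **Every package restricts to its anchor** (forget the graded de Rham data).
[cite: Saito1990, Thm. 0.1 and §4.5] -/
def CurveNetSaitoData.toAnchor {N : Motives.CurveNet m X} (K : CurveNetSaitoData N) :
    CurveNetHodgeAnchor N where
  I := K.IH 0
  finiteDimensional := K.finiteDimensional_IH 0
  hodge := K.hodgeIH 0
  isPolarizable := K.isPolarizable_hodgeIH 0
  supported := K.ihSupported
  supported_mono h := K.ihSupported_mono h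
  supported_univ := K.ihSupported_univ
  supported_empty := K.ihSupported_empty
  rho := K.rho
  surjective_rho := K.surjective_rho
  ker_rho := K.ker_rho
  rho_mul := K.rho_mul
  rho_rational := K.rho_rational
  rho_hodgeFiltration := K.rho_hodgeFiltration

/-- **`curveNetSaitoData_nonempty` is equivalent to the existence of anchors**: the named fact of
`SaitoGrFDeRhamCurveNet` pins exactly a finite-dimensional polarizable pure `ℚ`-Hodge structure with
supports, anchored to `H^{m+1}(X̃(ℂ); ℂ)` by the maps `ρ_F` — and nothing of Saito's graded de Rham
theory (module docstring, CONSEQUENCES). [cite: Saito1990, Thm. 0.1–0.2, §2.g and §4.5]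
[cite: DeligneHodgeII1971, Cor. 3.2.17] -/
theorem curveNetSaitoData_nonempty_iff_anchor :
    curveNetSaitoData_nonempty ↔
      ∀ ⦃m : ℕ⦄ ⦃X : Motives.SchemeOver ℂ⦄ (N : Motives.CurveNet m X), 2 ≤ m →
        Nonempty (CurveNetHodgeAnchor N) :=
  ⟨fun h _ _ N hm => (h N hm).map CurveNetSaitoData.toAnchor,
    fun h _ _ N hm => (h N hm).map CurveNetHodgeAnchor.toCurveNetSaitoData⟩

/-- In particular the named fact follows from the existence of anchors (the classical statement of
the module docstring). [cite: DeligneHodgeII1971, Cor. 3.2.17] [cite: Saito1990, Thm. 0.1] -/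
theorem curveNetSaitoData_nonempty_of_anchor
    (h : ∀ ⦃m : ℕ⦄ ⦃X : Motives.SchemeOver ℂ⦄ (N : Motives.CurveNet m X), 2 ≤ m →
      Nonempty (CurveNetHodgeAnchor N)) :
    curveNetSaitoData_nonempty :=
  curveNetSaitoData_nonempty_iff_anchor.mpr h

end HodgeTheory

end Literature.AlgebraicGeometry.HodgeTheory

end
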